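import Literature.Computability.AlgebraicComplexity.BorderComplexityAlder
import HarnessLib

/-!
# `\overline{VP}` is closed under p-projections, unconditionally (Bürgisser 2004, §4;
# Bürgisser 2024 survey, Def. 4.23; BLMW 2011, §9.3) — exact substitution bounds for `\underline{L}`

Topic `Computability/AlgebraicComplexity`. Cell `val-lit`, row Bur2024-A (Bürgisser 2024 survey
§4.7), fourth file of the §4.7 story (`BorderComplexityAlder.lean` Thm. 4.20,
`BorderComplexityEuclidean.lean` Thm. 4.19, `BorderComplexityInitialForms.lean` Rem. 4.21).
Bürgisser 2004, §4 (after Def. 2, held text `paper:arxiv-1812.06828` p0012 L42–L44): "If the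
polynomial `f` is a projection of a polynomial `g`, then we clearly have `L̲(f) ≤ L̲(g)`. Therefore,
the complexity class `\underline{VP}` is closed under `p`-projections." In the tree's ZARISKI rendering
`approxComplexity` (BLMW 2011 Def. 9.3.1) this was so far available only up to a truncation factor
— `ApproxComplexityProjections.lean`: `approxComplexity (aeval a F) ≤ (d+2)² · approxComplexity F +
(d+1) + Σ L(a_i)` for `deg F ≤ d`, whence `IsVPBarFamily.of_isPProjection` needed the degree of the
source family to be p-bounded — because Zariski continuity of a substitution on coefficient space
needs row-finiteness. Alder's theorem (`approxComplexity_eq_borderComplexity`, file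
`BorderComplexityAlder.lean`) removes the factor: in the `ε`-rendering substitution is plainly
monotone (`borderComplexity_aeval_le`: substitute into the border computation). Hence, over `ℂ`:

* `approxComplexity_aeval_le_sum` — `\underline{L}(F(a₁,…,aₙ)) ≤ \underline{L}(F) + Σᵢ L(aᵢ)` for ANY
  substitution (no homogeneity, no degree factor);
* `approxComplexity_le_of_isProjection'` — `\underline{L}(g) ≤ \underline{L}(f)` for a Valiant
  projection `g` of `f` (B04 §4, first sentence);
* `IsVPBarFamily.of_isPProjection'` — **`\overline{VP}` is closed under p-projections** with NO
  degree hypothesis (B04 §4, second sentence; BLMW 2011 §9.3; survey Def. 4.23's class).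

Theorems only; 0 definitions, 0 named facts. Honest framing: closure bookkeeping of a definition;
nothing here bears on `VP` versus `\overline{VP}` versus `VNP`, and `VP ≠ VNP` is NOT proved.

## References

* [Burgisser2004Factors] P. Bürgisser, Found. Comput. Math. 4 (2004) = arXiv:1812.06828, §4
  (definition of `\underline{VP}`, "closed under p-projections"), §2 (properties of `L̲`).
* [Burgisser2024Completeness] P. Bürgisser, arXiv:2406.06217 (2024), §4.7, Def. 4.23 (p0021).
* [BurgisserEtAl2011] Bürgisser–Landsberg–Manivel–Weyman, SIAM J. Comput. 40 (2011), §9.3.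
-/

noncomputable section

open MvPolynomial

namespace Literature.Computability.AlgebraicComplexity

section Substitution

variable {σ τ : Type*} [Fintype σ] [DecidableEq σ] [Fintype τ] [DecidableEq τ]

/-- **Exact substitution bound for `\underline{L}` over `ℂ`**: `\underline{L}(F(a)) ≤ \underline{L}(F) +
Σᵢ L(aᵢ)` for every substitution `a` (no homogeneity or degree hypothesis; via Alder's theorem and
substitution into a border computation). [cite: Burgisser2004Factors, §2 (properties of L̲) and §4] -/
theorem approxComplexity_aeval_le_sum (F : MvPolynomial σ ℂ) (a : σ → MvPolynomial τ ℂ) :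
    approxComplexity (aeval a F) ≤ approxComplexity F + ∑ i, complexity (a i) := by
  rw [approxComplexity_eq_borderComplexity, approxComplexity_eq_borderComplexity]
  exact borderComplexity_aeval_le a F

/-- **"If the polynomial `f` is a projection of a polynomial `g`, then we clearly have
`L̲(f) ≤ L̲(g)`"** (Bürgisser 2004 §4, p0012 L42–L43), for the tree's
Zariski rendering `approxComplexity` and Valiant projections `IsProjection`, with no degree factor
(compare `approxComplexity_le_of_isProjection` of `ApproxComplexityProjections.lean`).
[cite: Burgisser2004Factors, §4 (first sentence on `\underline{VP}`)] -/
theorem approxComplexity_le_of_isProjection' {g : MvPolynomial τ ℂ} {f : MvPolynomial σ ℂ}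
    (h : IsProjection g f) : approxComplexity g ≤ approxComplexity f := by
  obtain ⟨a, ha, rfl⟩ := h
  have h0 : ∑ i, complexity (a i) = 0 := by
    refine Finset.sum_eq_zero fun i _ => ?_
    rcases ha i with ⟨j, hj⟩ | ⟨c, hc⟩
    · rw [hj]; exact complexity_X_holds _
    · rw [hc]; exact complexity_C_holds _
  simpa [h0] using approxComplexity_aeval_le_sum f a

end Substitution

section Classes

/-- **`\overline{VP}` is closed under p-projections** (Bürgisser 2004 §4: "Therefore, the complexity
class `\underline{VP}` is closed under `p`-projections"; BLMW 2011 §9.3), for the tree's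
`IsVPBarFamily` and `IsPProjection`, WITHOUT the degree hypothesis of
`IsVPBarFamily.of_isPProjection`. [cite: Burgisser2004Factors, §4 (`\underline{VP}` closed under p-projections)] [cite: BurgisserEtAl2011, §9.3] [cite: Burgisser2024Completeness, Def. 4.23 (§4.7, p0021)] -/
theorem IsVPBarFamily.of_isPProjection' {σ τ : ℕ → Type*} [∀ n, Fintype (σ n)]
    [∀ n, DecidableEq (σ n)] [∀ n, Fintype (τ n)] [∀ n, DecidableEq (τ n)]
    {f : ∀ n, MvPolynomial (σ n) ℂ} {g : ∀ n, MvPolynomial (τ n) ℂ}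
    (hproj : IsPProjection g f) (hbar : IsVPBarFamily f) : IsVPBarFamily g := by
  obtain ⟨t, ht, hpr⟩ := hproj
  exact IsPBounded.mono (IsPBounded.comp_holds hbar ht)
    fun n => approxComplexity_le_of_isProjection' (hpr n)

end Classes

end Literature.Computability.AlgebraicComplexity

end
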